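import Summits.QuantumFields.BalabanUV.Beta.GAN24.WrecAtEvenHalfRowsOfWindowsSourcePairForm
import Summits.QuantumFields.BalabanUV.Beta.GAN24.LegSourceRowsThree
import Summits.QuantumFields.BalabanUV.Beta.GAN24.LegLetterWindowRows

/-!
# `BalabanUV.Beta.GAN24.WrecAtEvenHalfRowsOfNaturalWindows` — binder row G-an2-4 ∕ (CONV-C), W-slot, the (α-0) parity re-cut: **ROAD FP's D1 LITERAL OF RECORD FROM THE
# THREE NATURAL-WINDOW THEOREMS, THE SLAVED SLOT-DIVERGENCE ROWS OF THE EVEN MEMBERS, AND (C)sym — EVERY RATE AND THE LENGTH CHOSEN HERE** (G-an2-4 formalisation swarm,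
# leaf prover `b2b-balaban-gan24-formalise-leaf-03`, gen 69; FILE 3 of the journal INTENT [LEAF03-G69-ONLINE] ∕ A-1; THE ASSEMBLER announced in MY W-1 (b) to the OWNER
# gan24-p1 g38's INTENT 1 (b): MY g68 FILE 5 `WrecAtEvenHalfRowsOfWindows.exists_allScalesSeq_JsRowD1Pin_of_windows_CSym` with its five window rows DISCHARGED INTO the
# OWNER's three natural-window theorems — displayed here AS HYPOTHESES `HW1 ∕ HWs ∕ HWΔ` in EXACTLY the quantifier shape of parts 6 `NaturalWindowH1.h1_window_of_dressed_comb`,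
# 6b `NaturalWindowShort.short_windows_of_dressed_comb`, 12 `NaturalWindowDrift.drift_windows_of_dressed_comb` (staged, not yet in the tree; at the pin `c := cE₂`) —, its
# source ∕ level-0 rows (HS)(HSL)(Hx0)(HxL0)(HS′)(HSL′) DISCHARGED by MY g68 FILE 6 `LegSourceRowsThree` ⨾ FILE 1 `WindowSlotRows.exists_windowRows_of_locStencil₂`, and its
# slaved amplitude (H3)∕(H3d) READ from the two slaved slot-divergence rows of the even members (leaf-01 g72 (b1) PART 4's conclusion currency) by FILE 2
# `LegLetterWindowRows`; `GoodL ∕ GoodLS ∕ GoodLD :≡` the five slot rows at `δ ∕ δS ∕ δD`)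

**END-STATE TWIN (step 2 of 4; leaf-03 g70, regenerated from leaf-03's staged bytes by `gen/mk_twins.py`; recipe = road-P2 gan24-p2 g49 W-1 l.55974 ∕ offer W-2 l.56061, adopted by leaf-03 g69 W-2 l.56945):** leaf-03 g69 FILE 3 v1 `WrecAtEvenHalfRowsOfNaturalWindows` 7c81e8bcfa3ce3c6 RE-ROOTED on road-P2 g49 F11 `WrecAtEvenHalfRowsOfQLSourcePairForm`: the (C)sym binder `hS` ↦ the two binders `hSrc hSrcX` (per level `l ≥ 1` the leg-and-bond symmetrised `rowC` SOURCE charge is a PAIR FORM, and its CROSSED orbit sums vanish — texts byte-identical to F11's, from road-P2's `gen49/gen/mk_tower_defs.py`), import ∕ open ∕ namespace ∕ theorem name ∕ the pass-through call swapped accordingly. An ADDITIONAL file: the (C)sym original stands as staged ∕ filed. Discharges NOTHING of `hSrc` ∕ `hSrcX`.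

v1.1 (gen 74): the file-local helper `mul_le_of_le_div'` made `private` (its (C)sym original F3 `WrecAtEvenHalfRowsOfNaturalWindows` declares the same helper; the gate's `dedup.landed` compares printed statements tree-wide and ignores `private` ones — leaf-02 g70's probe l.60596); every other byte of v1 1d3fe75ebd34dbd3 unchanged (statements and proofs byte-identical).

NOT IN PRINT; OUR BOOKKEEPING ([folklore] composition BY NAME + the rate ∕ length arithmetic; 0 `def`, 0 cited facts, 0 `def … : Prop`, 0 sorry).  HONEST FRAMING (cell
contract, verbatim): «discharging `BetaPertH` makes Bałaban's UV stability UNCONDITIONAL — a real constructive-QFT result; it is NOT the continuum limit and NOT the Clay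
problem.»  HONEST DEPENDENCY (verbatim): «continuum YM on T⁴ ⇐ BetaPertH ∧ nine spine estimates (0/9 proved); BetaPertH ⇐ (D1) ∧ (D4) ∧ CAP+tail; G-an2-4 gates asym,
D1 and NE2/3/4.»

WHAT (`d = 3`, `Lc` odd, `2 ≤ Lc`, `2 ≤ N`, root `r = ctrOff 4 Lc`, the eight pins, `ε := 1`, `y_n := ½•(S̃₂(T₂)_n + P S̃₂(T₂)_n)` the even member):
**`exists_allScalesSeq_JsRowD1Pin_of_naturalWindows_CSym`** — `∃ κ θ, 0 ≤ θ < 1 ∧ AllScalesSeq (j ↦ secondMoment (TbalOf Lc (JsRowD1Pin …) j) μ ν) κ θ` from EXACTLY: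
`HW1` (the k₀-window: `∃ δ₁ > 0 ∀ δ ≤ δ₁ ∃ kmin ∀ k ≥ kmin ∃ θ < 1, Cg ∀ rr n W C g, bounded → LocStencil₂ W C δ → five rows (g, δ) → LocStencil₂ (T^{(k+1)} W) (θC + Cg·g) δ`),
`HWs` (the short windows: `∃ κ₁ > 0 ∀ δS δ, 0 < δ ≤ δS, 18(d+1)δ ≤ κ₁, 108(d+1)δ ≤ δS·Lc → ∀ k₀ ∃ A ≥ 1, B ∀ rr p q W C g, q < k₀ → … → LocStencil₂ (T^{(q)} W) (A·C + B·g) δ`),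
`HWΔ` (the kernel-drift windows: `∃ κΔ > 0, ν < 1 ∀ δ δD, 0 < δD ≤ δ, 18(d+1)δD ≤ κΔ, 108(d+1)δD ≤ δ·Lc → ∀ k₀ ∃ AΔ BΔ ∀ rr l q W C g, q < k₀ → … → LocStencil₂ (ΔT W) ((AΔC + BΔg)ν^l) δD`),
the slaved slot-divergence rows of the members `Hh₁ Hh₂` (constants `σ₁ σ₂`, ALL levels, one rate `δ₃ > 0`) and of their drifts `Hh₁d Hh₂d` (`σ₁d·ν₃^n`, `σ₂d·ν₃^n`), and (C)sym `hS`.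
THE ORDER (W-1 (b), the OWNER g38's RATE-ORDER INFO honoured): `δ₁, κ₁, (κΔ, ν_Δ)` and FILE 6's `(δ6, CF, cF, θF, C₀)` first; `δS := δ6∕3`;
`δ := min(δ₁, δS, κ₁∕(18(d+1)), δS·Lc∕(108(d+1)), δ₃∕3)`; `δD := min(δ, κΔ∕(18(d+1)), δ·Lc∕(108(d+1)))`; `k₀ := max(kmin(δ), kmin(δD)) + 1`; then the constants; `ν := max(ν_Δ, θF, ν₃)`.
Asserts NO shape of Bałaban's tables beyond the displayed rows and NO value of any charge; the three window theorems are HYPOTHESES here (discharged BY NAME by parts 6∕6b∕12 when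
they land — a ten-line successor file); NOTHING of (H1♮) ∕ (H1w) ∕ (H1Δw) ∕ (C)sym ∕ (β) discharged; NOT «W-slot closed»; NEVER «G-an2-4 closed» as (CONV-C); NOT D1 (the literal
is ONE road-FP instance under displayed rows), NOT `BetaPertH`, NOT continuum, NOT Clay; not in print.  Unit `b2b-balaban-gan24-formalise-leaf-03` (gen 69), 2026-08-23.
-/

noncomputable section

open Finset
open scoped BigOperators
open Literature.MathematicalPhysics.QuantumFieldTheory
open Literature.MathematicalPhysics.QuantumFieldTheory.Balaban1983to89
open Literature.MathematicalPhysics.QuantumFieldTheory.Balaban1983to89.Beta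
open B6BondElimination (unitVec)
open B12Sec2to5 (l1)
open ExpKernelCalculus (MKer shiftK)
open OneStepResolventKernel (Fib)
open OneStepKernelFamily (KInvStep TbalOf)
open RemainderConstAllScales (AllScalesSeq)
open AveragingContoursRooted (ctrOff ctrOff_mem_box)
open WilsonVertex2Sym (wsym22)
open AffineAveraging (box toSite)
open AveragingMixedJetTables (mixFFAt)
open KernelWard (divV)
open BalabanCompositeJets (LocStencil₂ LocStencil₂.nonneg)
open Summit.QuantumFields.BalabanUV.Beta.TameKernelCalculus (trK)
open Summit.QuantumFields.BalabanUV.Beta.BorderedHessian (sgnK)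
open Summit.QuantumFields.BalabanUV.Beta.HessKerDressedUnits (unitK)
open Summit.QuantumFields.BalabanUV.Beta.GAN24.T2RecursionAffine (lin4)
open Summit.QuantumFields.BalabanUV.Beta.SecondOrderUnits (unitS₂)
open Summit.QuantumFields.BalabanUV.Beta.AxialDressingRooted (coDressKBmAt)
open Summit.QuantumFields.BalabanUV.Beta.SpineRooted (T2RecOf T2RecAt SpureRecAt M1At)
open Summit.QuantumFields.BalabanUV.Beta.SecondOrderSocketIdentification (vh₂SAn1)
open Summit.QuantumFields.BalabanUV.Beta.SecondOrderTableLawEnd (locStencil₂_vh₂SAn1 vh₂SAn1_translate)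
open Summit.QuantumFields.BalabanUV.Beta.RowD1JointEnd (JsRowD1Pin)
open Summit.QuantumFields.BalabanUV.Beta.GAN24.CombesThomas (sfStep smStep)
open Summit.QuantumFields.BalabanUV.Beta.GAN24.BiStencilZeroMode (zmode)
open Summit.QuantumFields.BalabanUV.Beta.GAN24.Lin4LegTower (rdiv)
open Summit.QuantumFields.BalabanUV.Beta.GAN24.Lin4LegTowerUnroll (legStepB bsumPow legChain)
open Summit.QuantumFields.BalabanUV.Beta.GAN24.TransportMarginal (locStencil₂_weaken)
open Summit.QuantumFields.BalabanUV.Beta.GAN24.LegDriftRowsOfLegChain (rdiv_comp_sub)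
open Summit.QuantumFields.BalabanUV.Beta.GAN24.LegRowsOnRuledClass (halfMember_legLetter_mem halfMember_legDrift_mem)
open Summit.QuantumFields.BalabanUV.Beta.GAN24.LegSourceRowsThree (exists_halfSource_rows_three)
open Summit.QuantumFields.BalabanUV.Beta.GAN24.WindowSlotRows (exists_windowRows_of_locStencil₂ windowRows_weaken)
open Summit.QuantumFields.BalabanUV.Beta.GAN24.LegLetterWindowRows (exists_windowRows_legLetter_of_divRows)
open Summit.QuantumFields.BalabanUV.Beta.GAN24.WrecAtEvenHalfRowsOfWindowsSourcePairForm (exists_allScalesSeq_JsRowD1Pin_of_windows_sourcePairForm)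

namespace Summit.QuantumFields.BalabanUV.Beta.GAN24.WrecAtEvenHalfRowsOfNaturalWindowsSourcePairForm

variable {Lc : ℕ} [NeZero Lc]

/-- [folklore] `min`-arithmetic: `x ≤ a∕b` with `0 < b` gives `b·x ≤ a` (`private`: its (C)sym original F3 `WrecAtEvenHalfRowsOfNaturalWindows` declares the same helper — a public twin would bounce `dedup.landed` for whichever file lands second). -/
private theorem mul_le_of_le_div' {x a b : ℝ} (hb : 0 < b) (h : x ≤ a / b) : b * x ≤ a := by
  rw [mul_comm]; exact (le_div_iff₀ hb).mp h

/-- NOT IN PRINT; OUR BOOKKEEPING.  **ROAD FP's D1 LITERAL FROM THE THREE NATURAL-WINDOW THEOREMS (AS HYPOTHESES, THE OWNER's SHAPES), THE SLAVED SLOT-DIVERGENCE ROWS OF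
THE EVEN MEMBERS AND THEIR DRIFTS, AND (C)sym** — MY g68 FILE 5 with `GoodL ∕ GoodLS ∕ GoodLD :≡` the five slot rows at `δ ∕ δS ∕ δD`, every source ∕ level-0 row a theorem
(FILE 6 ⨾ FILE 1), (H3)∕(H3d) read from `Hh₁ Hh₂ Hh₁d Hh₂d` (FILE 2 over 8b's class membership of the members), the rates and the length chosen in the order of the docstring. -/
theorem exists_allScalesSeq_JsRowD1Pin_of_naturalWindows_sourcePairForm (hLc : Odd Lc) (hL2 : 2 ≤ Lc) {N : ℕ} (hN : 2 ≤ N) {r : Fin (3 + 1) → ℕ} (hr : r = ctrOff (3 + 1) Lc)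
    {cE cVH cΛ cE₂ cB : ℝ} (hcE : cE = (Lc : ℝ) ^ (3 + 1)) (hcVH : cVH = -((Lc : ℝ) ^ (3 + 1) * (1 / 2) * (Lc : ℝ) ^ (3 + 1))) (hcΛ : cΛ = 2 / (Lc : ℝ) ^ 4) (hcE₂ : cE₂ = (Lc : ℝ) ^ (2 * (3 + 1)))
    (hcB : cB = -((Lc : ℝ) ^ 12 / 4)) {Tc : Fin 4 → Fin 4 → Fin 4 → Fin 4 → ℝ} (hTc : Tc = (8 * (N : ℝ) ^ 2)⁻¹ • wsym22 N)
    {vh₂S : (Fin (3 + 1) → (Fin (3 + 1) → ℤ) → Fin (3 + 1) → (Fin (3 + 1) → ℤ) → MKer (3 + 1) (Fib 3))} (hvh : vh₂S = vh₂SAn1 Lc)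
    (HW1 : ∃ δ₁ : ℝ, 0 < δ₁ ∧ ∀ δ : ℝ, 0 < δ → δ ≤ δ₁ → ∃ kmin : ℕ, ∀ k : ℕ, kmin ≤ k →
      ∃ θ Cg : ℝ, 0 ≤ θ ∧ θ < 1 ∧ 0 ≤ Cg ∧ ∀ (rr : Fin (3 + 1) → ℕ), rr ∈ box (3 + 1) Lc →
        ∀ (n : ℕ) (W : (Fin (3 + 1) → (Fin (3 + 1) → ℤ) → Fin (3 + 1) → (Fin (3 + 1) → ℤ) → MKer (3 + 1) (Fib 3))) (C g : ℝ),
          (∃ B : ℝ, ∀ κ u κ' u' x z a b, |W κ u κ' u' x z a b| ≤ B) → LocStencil₂ W C δ →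
          (∀ (κ₁ : Fin (3 + 1)) (v : Fin (3 + 1) → ℤ) (κ₂ : Fin (3 + 1)) (x p : Fin (3 + 1) → ℤ) (f b : Fib 3),
              |∑' v', W κ₁ v κ₂ v' x p f b| ≤ g * Real.exp (-δ * (l1 (x - v) + l1 (p - v)))) →
          (∀ (κ₁ κ₂ : Fin (3 + 1)) (v' x p : Fin (3 + 1) → ℤ) (f b : Fib 3),
              |∑' v, W κ₁ v κ₂ v' x p f b| ≤ g * Real.exp (-δ * (l1 (x - v') + l1 (p - v')))) →
          (∀ (κ₁ κ₂ : Fin (3 + 1)) (x p : Fin (3 + 1) → ℤ) (f b : Fib 3),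
              |∑' v, ∑' v', W κ₁ v κ₂ v' x p f b| ≤ g * Real.exp (-δ * l1 (p - x))) →
          (∀ (κ : Fin (3 + 1)) (v w x p : Fin (3 + 1) → ℤ) (f b : Fib 3),
              |∑ μ, (W κ v μ (w - unitVec μ) x p f b - W κ v μ w x p f b)|
                ≤ g * Real.exp (-δ * l1 (w - v)) * Real.exp (-δ * (l1 (x - v) + l1 (p - v)))) →
          (∀ (κ' : Fin (3 + 1)) (w v' x p : Fin (3 + 1) → ℤ) (f b : Fib 3),
              |∑ κ, (W κ (w - unitVec κ) κ' v' x p f b - W κ w κ' v' x p f b)|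
                ≤ g * Real.exp (-δ * l1 (v' - w)) * Real.exp (-δ * (l1 (x - w) + l1 (p - w)))) →
          LocStencil₂ (legChain (fun _ : ℕ => -((cE₂ * (Lc : ℝ) ^ (2 * (3 + 1))) * ((Lc : ℝ) ^ (3 + 1))⁻¹))
              (fun m => unitK (sfStep Lc m) (smStep 3 Lc m) (coDressKBmAt (toSite rr) Lc (KInvStep (d := 3) Lc m))) Lc n (k + 1)
              (fun κ u κ' u' => bsumPow Lc (k + 1) (W κ u κ' u'))) (θ * C + Cg * g) δ)
    (HWs : ∃ κ₁ : ℝ, 0 < κ₁ ∧ ∀ δS δ : ℝ, 0 < δ → δ ≤ δS → 18 * (((3 : ℕ) : ℝ) + 1) * δ ≤ κ₁ → 108 * (((3 : ℕ) : ℝ) + 1) * δ ≤ δS * (Lc : ℝ) →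
      ∀ k₀ : ℕ, ∃ A B : ℝ, 1 ≤ A ∧ 0 ≤ B ∧ ∀ (rr : Fin (3 + 1) → ℕ), rr ∈ box (3 + 1) Lc → ∀ (p q : ℕ) (W : (Fin (3 + 1) → (Fin (3 + 1) → ℤ) → Fin (3 + 1) → (Fin (3 + 1) → ℤ) → MKer (3 + 1) (Fib 3))) (C g : ℝ), q < k₀ →
          (∃ B' : ℝ, ∀ κ u κ' u' x z a b, |W κ u κ' u' x z a b| ≤ B') → LocStencil₂ W C δS →
          (∀ (κ₁ : Fin (3 + 1)) (v : Fin (3 + 1) → ℤ) (κ₂ : Fin (3 + 1)) (x p : Fin (3 + 1) → ℤ) (f b : Fib 3),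
              |∑' v', W κ₁ v κ₂ v' x p f b| ≤ g * Real.exp (-δS * (l1 (x - v) + l1 (p - v)))) →
          (∀ (κ₁ κ₂ : Fin (3 + 1)) (v' x p : Fin (3 + 1) → ℤ) (f b : Fib 3),
              |∑' v, W κ₁ v κ₂ v' x p f b| ≤ g * Real.exp (-δS * (l1 (x - v') + l1 (p - v')))) →
          (∀ (κ₁ κ₂ : Fin (3 + 1)) (x p : Fin (3 + 1) → ℤ) (f b : Fib 3),
              |∑' v, ∑' v', W κ₁ v κ₂ v' x p f b| ≤ g * Real.exp (-δS * l1 (p - x))) →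
          (∀ (κ : Fin (3 + 1)) (v w x p : Fin (3 + 1) → ℤ) (f b : Fib 3),
              |∑ μ, (W κ v μ (w - unitVec μ) x p f b - W κ v μ w x p f b)|
                ≤ g * Real.exp (-δS * l1 (w - v)) * Real.exp (-δS * (l1 (x - v) + l1 (p - v)))) →
          (∀ (κ' : Fin (3 + 1)) (w v' x p : Fin (3 + 1) → ℤ) (f b : Fib 3),
              |∑ κ, (W κ (w - unitVec κ) κ' v' x p f b - W κ w κ' v' x p f b)|
                ≤ g * Real.exp (-δS * l1 (v' - w)) * Real.exp (-δS * (l1 (x - w) + l1 (p - w)))) →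
          LocStencil₂ (legChain (fun _ : ℕ => -((cE₂ * (Lc : ℝ) ^ (2 * (3 + 1))) * ((Lc : ℝ) ^ (3 + 1))⁻¹))
              (fun m => unitK (sfStep Lc m) (smStep 3 Lc m) (coDressKBmAt (toSite rr) Lc (KInvStep (d := 3) Lc m))) Lc p q
              (fun κ u κ' u' => bsumPow Lc q (W κ u κ' u'))) (A * C + B * g) δ)
    (HWΔ : ∃ κΔ ν : ℝ, 0 < κΔ ∧ 0 ≤ ν ∧ ν < 1 ∧ ∀ δ δD : ℝ, 0 < δD → δD ≤ δ → 18 * (((3 : ℕ) : ℝ) + 1) * δD ≤ κΔ → 108 * (((3 : ℕ) : ℝ) + 1) * δD ≤ δ * (Lc : ℝ) →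
      ∀ k₀ : ℕ, ∃ AΔ BΔ : ℝ, 0 ≤ AΔ ∧ 0 ≤ BΔ ∧ ∀ (rr : Fin (3 + 1) → ℕ), rr ∈ box (3 + 1) Lc → ∀ (l q : ℕ) (W : (Fin (3 + 1) → (Fin (3 + 1) → ℤ) → Fin (3 + 1) → (Fin (3 + 1) → ℤ) → MKer (3 + 1) (Fib 3))) (C g : ℝ), q < k₀ →
          (∃ B : ℝ, ∀ κ u κ' u' x z a b, |W κ u κ' u' x z a b| ≤ B) → LocStencil₂ W C δ →
          (∀ (κ₁ : Fin (3 + 1)) (v : Fin (3 + 1) → ℤ) (κ₂ : Fin (3 + 1)) (x p : Fin (3 + 1) → ℤ) (f b : Fib 3),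
              |∑' v', W κ₁ v κ₂ v' x p f b| ≤ g * Real.exp (-δ * (l1 (x - v) + l1 (p - v)))) →
          (∀ (κ₁ κ₂ : Fin (3 + 1)) (v' x p : Fin (3 + 1) → ℤ) (f b : Fib 3),
              |∑' v, W κ₁ v κ₂ v' x p f b| ≤ g * Real.exp (-δ * (l1 (x - v') + l1 (p - v')))) →
          (∀ (κ₁ κ₂ : Fin (3 + 1)) (x p : Fin (3 + 1) → ℤ) (f b : Fib 3),
              |∑' v, ∑' v', W κ₁ v κ₂ v' x p f b| ≤ g * Real.exp (-δ * l1 (p - x))) →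
          (∀ (κ : Fin (3 + 1)) (v w x p : Fin (3 + 1) → ℤ) (f b : Fib 3),
              |∑ μ, (W κ v μ (w - unitVec μ) x p f b - W κ v μ w x p f b)|
                ≤ g * Real.exp (-δ * l1 (w - v)) * Real.exp (-δ * (l1 (x - v) + l1 (p - v)))) →
          (∀ (κ' : Fin (3 + 1)) (w v' x p : Fin (3 + 1) → ℤ) (f b : Fib 3),
              |∑ κ, (W κ (w - unitVec κ) κ' v' x p f b - W κ w κ' v' x p f b)|
                ≤ g * Real.exp (-δ * l1 (v' - w)) * Real.exp (-δ * (l1 (x - w) + l1 (p - w)))) →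
          LocStencil₂ (legChain (fun _ : ℕ => -((cE₂ * (Lc : ℝ) ^ (2 * (3 + 1))) * ((Lc : ℝ) ^ (3 + 1))⁻¹))
              (fun m => unitK (sfStep Lc m) (smStep 3 Lc m) (coDressKBmAt (toSite rr) Lc (KInvStep (d := 3) Lc m))) Lc (l + 2) q
              (fun κ u κ' u' => bsumPow Lc q ((legStepB (fun _ : ℕ => -((cE₂ * (Lc : ℝ) ^ (2 * (3 + 1))) * ((Lc : ℝ) ^ (3 + 1))⁻¹))
                  (fun m => unitK (sfStep Lc m) (smStep 3 Lc m) (coDressKBmAt (toSite rr) Lc (KInvStep (d := 3) Lc m))) Lc (l + 1) W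
                - legStepB (fun _ : ℕ => -((cE₂ * (Lc : ℝ) ^ (2 * (3 + 1))) * ((Lc : ℝ) ^ (3 + 1))⁻¹))
                  (fun m => unitK (sfStep Lc m) (smStep 3 Lc m) (coDressKBmAt (toSite rr) Lc (KInvStep (d := 3) Lc m))) Lc l W) κ u κ' u'))) ((AΔ * C + BΔ * g) * ν ^ l) δD)
    {δ₃ σ₁ σ₂ σ₁d σ₂d ν₃ : ℝ} (hδ₃ : 0 < δ₃) (hν₃0 : 0 ≤ ν₃) (hν₃1 : ν₃ < 1)
    (Hh₁ : ∀ n : ℕ, LocStencil₂ (fun (_ : Fin (3 + 1)) (p : Fin (3 + 1) → ℤ) (κ' : Fin (3 + 1)) (u' : Fin (3 + 1) → ℤ) =>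
      divV (fun κ₁ u₁ => (((1 : ℝ) / 2) • (unitS₂ (sfStep Lc n) (smStep 3 Lc n) (T2RecAt 3 Lc (toSite r) cE cVH cΛ cE₂ cB Tc vh₂S (mixFFAt (toSite r) Lc) n) + (1 : ℝ) • fun κ u κ' u' => sgnK (trK ((unitS₂ (sfStep Lc n) (smStep 3 Lc n) (T2RecAt 3 Lc (toSite r) cE cVH cΛ cE₂ cB Tc vh₂S (mixFFAt (toSite r) Lc) n)) κ u κ' u')))) κ₁ u₁ κ' u') p) σ₁ δ₃)
    (Hh₂ : ∀ n : ℕ, LocStencil₂ (fun (κ : Fin (3 + 1)) (u : Fin (3 + 1) → ℤ) (_ : Fin (3 + 1)) (p : Fin (3 + 1) → ℤ) =>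
      divV (fun κ₁ u₁ => (((1 : ℝ) / 2) • (unitS₂ (sfStep Lc n) (smStep 3 Lc n) (T2RecAt 3 Lc (toSite r) cE cVH cΛ cE₂ cB Tc vh₂S (mixFFAt (toSite r) Lc) n) + (1 : ℝ) • fun κ u κ' u' => sgnK (trK ((unitS₂ (sfStep Lc n) (smStep 3 Lc n) (T2RecAt 3 Lc (toSite r) cE cVH cΛ cE₂ cB Tc vh₂S (mixFFAt (toSite r) Lc) n)) κ u κ' u')))) κ u κ₁ u₁) p) σ₂ δ₃)
    (Hh₁d : ∀ n : ℕ, LocStencil₂ (fun (_ : Fin (3 + 1)) (p : Fin (3 + 1) → ℤ) (κ' : Fin (3 + 1)) (u' : Fin (3 + 1) → ℤ) =>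
      divV (fun κ₁ u₁ => ((((1 : ℝ) / 2) • (unitS₂ (sfStep Lc (n + 1)) (smStep 3 Lc (n + 1)) (T2RecAt 3 Lc (toSite r) cE cVH cΛ cE₂ cB Tc vh₂S (mixFFAt (toSite r) Lc) (n + 1)) + (1 : ℝ) • fun κ u κ' u' => sgnK (trK ((unitS₂ (sfStep Lc (n + 1)) (smStep 3 Lc (n + 1)) (T2RecAt 3 Lc (toSite r) cE cVH cΛ cE₂ cB Tc vh₂S (mixFFAt (toSite r) Lc) (n + 1))) κ u κ' u'))))
        - (((1 : ℝ) / 2) • (unitS₂ (sfStep Lc n) (smStep 3 Lc n) (T2RecAt 3 Lc (toSite r) cE cVH cΛ cE₂ cB Tc vh₂S (mixFFAt (toSite r) Lc) n) + (1 : ℝ) • fun κ u κ' u' => sgnK (trK ((unitS₂ (sfStep Lc n) (smStep 3 Lc n) (T2RecAt 3 Lc (toSite r) cE cVH cΛ cE₂ cB Tc vh₂S (mixFFAt (toSite r) Lc) n)) κ u κ' u'))))) κ₁ u₁ κ' u') p) (σ₁d * ν₃ ^ n) δ₃)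
    (Hh₂d : ∀ n : ℕ, LocStencil₂ (fun (κ : Fin (3 + 1)) (u : Fin (3 + 1) → ℤ) (_ : Fin (3 + 1)) (p : Fin (3 + 1) → ℤ) =>
      divV (fun κ₁ u₁ => ((((1 : ℝ) / 2) • (unitS₂ (sfStep Lc (n + 1)) (smStep 3 Lc (n + 1)) (T2RecAt 3 Lc (toSite r) cE cVH cΛ cE₂ cB Tc vh₂S (mixFFAt (toSite r) Lc) (n + 1)) + (1 : ℝ) • fun κ u κ' u' => sgnK (trK ((unitS₂ (sfStep Lc (n + 1)) (smStep 3 Lc (n + 1)) (T2RecAt 3 Lc (toSite r) cE cVH cΛ cE₂ cB Tc vh₂S (mixFFAt (toSite r) Lc) (n + 1))) κ u κ' u'))))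
        - (((1 : ℝ) / 2) • (unitS₂ (sfStep Lc n) (smStep 3 Lc n) (T2RecAt 3 Lc (toSite r) cE cVH cΛ cE₂ cB Tc vh₂S (mixFFAt (toSite r) Lc) n) + (1 : ℝ) • fun κ u κ' u' => sgnK (trK ((unitS₂ (sfStep Lc n) (smStep 3 Lc n) (T2RecAt 3 Lc (toSite r) cE cVH cΛ cE₂ cB Tc vh₂S (mixFFAt (toSite r) Lc) n)) κ u κ' u'))))) κ u κ₁ u₁) p) (σ₂d * ν₃ ^ n) δ₃)
    (hSrc : ∀ l : ℕ, ∃ S : Fin (3 + 1) → Fin (3 + 1) → Fin (3 + 1) → Fin (3 + 1) → ℝ,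
      (∀ a b c e, S b a c e = -S a b c e) ∧ (∀ a b c e, S a b e c = -S a b c e) ∧
      ∀ κ κ' κ₁ κ₂ : Fin (3 + 1),
      (zmode Lc ((unitS₂ (sfStep Lc ((l + 1) + 1)) (smStep 3 Lc ((l + 1) + 1)) (T2RecAt 3 Lc (toSite r) cE cVH cΛ cE₂ cB Tc vh₂S (mixFFAt (toSite r) Lc) ((l + 1) + 1)))
             - lin4 (cE₂ * (Lc : ℝ) ^ (2 * (3 + 1))) (unitK (sfStep Lc (l + 1)) (smStep 3 Lc (l + 1)) (KInvStep (d := 3) Lc (l + 1))) Lc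
               (unitS₂ (sfStep Lc (l + 1)) (smStep 3 Lc (l + 1)) (T2RecAt 3 Lc (toSite r) cE cVH cΛ cE₂ cB Tc vh₂S (mixFFAt (toSite r) Lc) (l + 1)))) κ κ' (Sum.inl κ₁) (Sum.inl κ₂)
         + zmode Lc ((unitS₂ (sfStep Lc ((l + 1) + 1)) (smStep 3 Lc ((l + 1) + 1)) (T2RecAt 3 Lc (toSite r) cE cVH cΛ cE₂ cB Tc vh₂S (mixFFAt (toSite r) Lc) ((l + 1) + 1)))
             - lin4 (cE₂ * (Lc : ℝ) ^ (2 * (3 + 1))) (unitK (sfStep Lc (l + 1)) (smStep 3 Lc (l + 1)) (KInvStep (d := 3) Lc (l + 1))) Lc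
               (unitS₂ (sfStep Lc (l + 1)) (smStep 3 Lc (l + 1)) (T2RecAt 3 Lc (toSite r) cE cVH cΛ cE₂ cB Tc vh₂S (mixFFAt (toSite r) Lc) (l + 1)))) κ' κ (Sum.inl κ₁) (Sum.inl κ₂))
      + (zmode Lc ((unitS₂ (sfStep Lc ((l + 1) + 1)) (smStep 3 Lc ((l + 1) + 1)) (T2RecAt 3 Lc (toSite r) cE cVH cΛ cE₂ cB Tc vh₂S (mixFFAt (toSite r) Lc) ((l + 1) + 1)))
             - lin4 (cE₂ * (Lc : ℝ) ^ (2 * (3 + 1))) (unitK (sfStep Lc (l + 1)) (smStep 3 Lc (l + 1)) (KInvStep (d := 3) Lc (l + 1))) Lc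
               (unitS₂ (sfStep Lc (l + 1)) (smStep 3 Lc (l + 1)) (T2RecAt 3 Lc (toSite r) cE cVH cΛ cE₂ cB Tc vh₂S (mixFFAt (toSite r) Lc) (l + 1)))) κ κ' (Sum.inl κ₂) (Sum.inl κ₁)
         + zmode Lc ((unitS₂ (sfStep Lc ((l + 1) + 1)) (smStep 3 Lc ((l + 1) + 1)) (T2RecAt 3 Lc (toSite r) cE cVH cΛ cE₂ cB Tc vh₂S (mixFFAt (toSite r) Lc) ((l + 1) + 1)))
             - lin4 (cE₂ * (Lc : ℝ) ^ (2 * (3 + 1))) (unitK (sfStep Lc (l + 1)) (smStep 3 Lc (l + 1)) (KInvStep (d := 3) Lc (l + 1))) Lc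
               (unitS₂ (sfStep Lc (l + 1)) (smStep 3 Lc (l + 1)) (T2RecAt 3 Lc (toSite r) cE cVH cΛ cE₂ cB Tc vh₂S (mixFFAt (toSite r) Lc) (l + 1)))) κ' κ (Sum.inl κ₂) (Sum.inl κ₁))
        = S κ κ₁ κ' κ₂ + S κ' κ₁ κ κ₂ + (S κ κ₂ κ' κ₁ + S κ' κ₂ κ κ₁))
    (hSrcX : ∀ (l : ℕ) (a b : Fin (3 + 1)), a ≠ b →
      (zmode Lc ((unitS₂ (sfStep Lc ((l + 1) + 1)) (smStep 3 Lc ((l + 1) + 1)) (T2RecAt 3 Lc (toSite r) cE cVH cΛ cE₂ cB Tc vh₂S (mixFFAt (toSite r) Lc) ((l + 1) + 1)))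
             - lin4 (cE₂ * (Lc : ℝ) ^ (2 * (3 + 1))) (unitK (sfStep Lc (l + 1)) (smStep 3 Lc (l + 1)) (KInvStep (d := 3) Lc (l + 1))) Lc
               (unitS₂ (sfStep Lc (l + 1)) (smStep 3 Lc (l + 1)) (T2RecAt 3 Lc (toSite r) cE cVH cΛ cE₂ cB Tc vh₂S (mixFFAt (toSite r) Lc) (l + 1)))) a b (Sum.inl a) (Sum.inl b)
         + zmode Lc ((unitS₂ (sfStep Lc ((l + 1) + 1)) (smStep 3 Lc ((l + 1) + 1)) (T2RecAt 3 Lc (toSite r) cE cVH cΛ cE₂ cB Tc vh₂S (mixFFAt (toSite r) Lc) ((l + 1) + 1)))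
             - lin4 (cE₂ * (Lc : ℝ) ^ (2 * (3 + 1))) (unitK (sfStep Lc (l + 1)) (smStep 3 Lc (l + 1)) (KInvStep (d := 3) Lc (l + 1))) Lc
               (unitS₂ (sfStep Lc (l + 1)) (smStep 3 Lc (l + 1)) (T2RecAt 3 Lc (toSite r) cE cVH cΛ cE₂ cB Tc vh₂S (mixFFAt (toSite r) Lc) (l + 1)))) b a (Sum.inl a) (Sum.inl b))
      + (zmode Lc ((unitS₂ (sfStep Lc ((l + 1) + 1)) (smStep 3 Lc ((l + 1) + 1)) (T2RecAt 3 Lc (toSite r) cE cVH cΛ cE₂ cB Tc vh₂S (mixFFAt (toSite r) Lc) ((l + 1) + 1)))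
             - lin4 (cE₂ * (Lc : ℝ) ^ (2 * (3 + 1))) (unitK (sfStep Lc (l + 1)) (smStep 3 Lc (l + 1)) (KInvStep (d := 3) Lc (l + 1))) Lc
               (unitS₂ (sfStep Lc (l + 1)) (smStep 3 Lc (l + 1)) (T2RecAt 3 Lc (toSite r) cE cVH cΛ cE₂ cB Tc vh₂S (mixFFAt (toSite r) Lc) (l + 1)))) a b (Sum.inl b) (Sum.inl a)
         + zmode Lc ((unitS₂ (sfStep Lc ((l + 1) + 1)) (smStep 3 Lc ((l + 1) + 1)) (T2RecAt 3 Lc (toSite r) cE cVH cΛ cE₂ cB Tc vh₂S (mixFFAt (toSite r) Lc) ((l + 1) + 1)))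
             - lin4 (cE₂ * (Lc : ℝ) ^ (2 * (3 + 1))) (unitK (sfStep Lc (l + 1)) (smStep 3 Lc (l + 1)) (KInvStep (d := 3) Lc (l + 1))) Lc
               (unitS₂ (sfStep Lc (l + 1)) (smStep 3 Lc (l + 1)) (T2RecAt 3 Lc (toSite r) cE cVH cΛ cE₂ cB Tc vh₂S (mixFFAt (toSite r) Lc) (l + 1)))) b a (Sum.inl b) (Sum.inl a)) = 0)
    (μ ν' : Fin 4) :
    ∃ κ θ' : ℝ, 0 ≤ θ' ∧ θ' < 1 ∧ AllScalesSeq (fun j => B12Beta.secondMoment (TbalOf Lc (JsRowD1Pin hLc N) j) μ ν') κ θ' := by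
  have hLc1 : 1 ≤ Lc := by omega
  have hLpos : (0 : ℝ) < (Lc : ℝ) := by exact_mod_cast (show 0 < Lc by omega)
  have hrb : r ∈ box (3 + 1) Lc := by rw [hr]; exact ctrOff_mem_box hLc.pos
  have hB : ∃ C δ : ℝ, 0 < δ ∧ LocStencil₂ vh₂S C δ := by rw [hvh]; exact locStencil₂_vh₂SAn1 hLc
  have hBt : ∀ (κ : Fin (3 + 1)) (u : Fin (3 + 1) → ℤ) (κ' : Fin (3 + 1)) (u' t : Fin (3 + 1) → ℤ),
      vh₂S κ (u + (Lc : ℤ) • t) κ' (u' + (Lc : ℤ) • t) = shiftK (-((Lc : ℤ) • t)) (vh₂S κ u κ' u') := by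
    intro κ u κ' u' t; rw [hvh]; exact vh₂SAn1_translate hLc1 κ u κ' u' t
  -- FILE 6: the source ∕ source-drift ∕ level-0 rows are theorems at `d = 3` (`ε := 1`), one rate `δ6`
  obtain ⟨δ6, hδ6, CF, cF, θF, C₀, hθF0, hθF1, HS6, HS6', Hx06⟩ :=
    exists_halfSource_rows_three hL2 hrb hcE cVH cΛ cE₂ cB Tc hB (ε := (1 : ℝ)) (by norm_num)
  have hCF : 0 ≤ CF := (HS6 0).nonneg
  have hC₀ : 0 ≤ C₀ := Hx06.nonneg
  have hcF : 0 ≤ cF := by have h := (HS6' 0).nonneg; rwa [pow_zero, mul_one] at h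
  -- FILE 1 §4 (the sources' five rows at `δ6/3`) and FILE 2 (the members' five rows at `δ₃/3`)
  obtain ⟨Γ₄, hΓ₄0, hΓ₄⟩ := exists_windowRows_of_locStencil₂ 3 hδ6
  obtain ⟨Γ₂, hΓ₂0, hΓ₂⟩ := exists_windowRows_legLetter_of_divRows 3 hδ₃
  -- the three window theorems' rate ceilings (root-, rate-, length-free)
  obtain ⟨δ₁, hδ₁, HW1'⟩ := HW1
  obtain ⟨κ₁, hκ₁, HWs'⟩ := HWs
  obtain ⟨κΔ, νΔ, hκΔ, hνΔ0, hνΔ1, HWΔ'⟩ := HWΔ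
  -- THE RATES: `δS`, then `δ`, then `δD` — all before the length
  have hc4 : (0 : ℝ) < ((3 : ℕ) : ℝ) + 1 := by positivity
  have h18 : (0 : ℝ) < 18 * (((3 : ℕ) : ℝ) + 1) := by positivity
  have h108 : (0 : ℝ) < 108 * (((3 : ℕ) : ℝ) + 1) := by positivity
  set δS : ℝ := δ6 / 3 with hδS
  have hδSpos : 0 < δS := by positivity
  have hδS6 : δS ≤ δ6 := by rw [hδS]; linarith
  set δ : ℝ := min (min (min δ₁ δS) (min (κ₁ / (18 * (((3 : ℕ) : ℝ) + 1))) (δS * (Lc : ℝ) / (108 * (((3 : ℕ) : ℝ) + 1))))) (δ₃ / 3) with hδdef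
  have hδpos : 0 < δ := lt_min (lt_min (lt_min hδ₁ hδSpos) (lt_min (by positivity) (by positivity))) (by positivity)
  have hδ_δ₁ : δ ≤ δ₁ := (min_le_left _ _).trans ((min_le_left _ _).trans (min_le_left _ _))
  have hδ_δS : δ ≤ δS := (min_le_left _ _).trans ((min_le_left _ _).trans (min_le_right _ _))
  have hδ_κ₁ : 18 * (((3 : ℕ) : ℝ) + 1) * δ ≤ κ₁ :=
    mul_le_of_le_div' h18 ((min_le_left _ _).trans ((min_le_right _ _).trans (min_le_left _ _)))
  have hδ_gap : 108 * (((3 : ℕ) : ℝ) + 1) * δ ≤ δS * (Lc : ℝ) :=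
    mul_le_of_le_div' h108 ((min_le_left _ _).trans ((min_le_right _ _).trans (min_le_right _ _)))
  have hδ_δ₃ : δ ≤ δ₃ / 3 := min_le_right _ _
  set δD : ℝ := min δ (min (κΔ / (18 * (((3 : ℕ) : ℝ) + 1))) (δ * (Lc : ℝ) / (108 * (((3 : ℕ) : ℝ) + 1)))) with hδDdef
  have hδDpos : 0 < δD := lt_min hδpos (lt_min (by positivity) (by positivity))
  have hδD_δ : δD ≤ δ := min_le_left _ _
  have hδD_κΔ : 18 * (((3 : ℕ) : ℝ) + 1) * δD ≤ κΔ := mul_le_of_le_div' h18 ((min_le_right _ _).trans (min_le_left _ _))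
  have hδD_gap : 108 * (((3 : ℕ) : ℝ) + 1) * δD ≤ δ * (Lc : ℝ) := mul_le_of_le_div' h108 ((min_le_right _ _).trans (min_le_right _ _))
  have hδD_δ₁ : δD ≤ δ₁ := hδD_δ.trans hδ_δ₁
  have hδD_δS : δD ≤ δS := hδD_δ.trans hδ_δS
  have hδD_κ₁ : 18 * (((3 : ℕ) : ℝ) + 1) * δD ≤ κ₁ := (mul_le_mul_of_nonneg_left hδD_δ h18.le).trans hδ_κ₁
  have hδD_gapS : 108 * (((3 : ℕ) : ℝ) + 1) * δD ≤ δS * (Lc : ℝ) := (mul_le_mul_of_nonneg_left hδD_δ h108.le).trans hδ_gap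
  have hδD_δ₃ : δD ≤ δ₃ / 3 := hδD_δ.trans hδ_δ₃
  -- THE LENGTH
  obtain ⟨kmin, Hk⟩ := HW1' δ hδpos hδ_δ₁
  obtain ⟨kminD, HkD⟩ := HW1' δD hδDpos hδD_δ₁
  obtain ⟨θ, Cg, hθ0, hθ1, hCg, H1c⟩ := Hk (max kmin kminD) (le_max_left _ _)
  obtain ⟨θD, CgD, hθD0, hθD1, hCgD, H1Dc⟩ := HkD (max kmin kminD) (le_max_right _ _)
  have hk₀ : 0 < max kmin kminD + 1 := Nat.succ_pos _
  -- THE CONSTANTS (after the length)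
  obtain ⟨A, B, hA1, hB0, Hwc⟩ := HWs' δS δ hδpos hδ_δS hδ_κ₁ hδ_gap (max kmin kminD + 1)
  obtain ⟨AD, BD, hAD1, hBD0, HwDc⟩ := HWs' δS δD hδDpos hδD_δS hδD_κ₁ hδD_gapS (max kmin kminD + 1)
  obtain ⟨AΔ, BΔ, hAΔ, hBΔ, HΔc⟩ := HWΔ' δ δD hδDpos hδD_δ hδD_κΔ hδD_gap (max kmin kminD + 1)
  -- ONE geometric rate for the drift display
  set ν : ℝ := max νΔ (max θF ν₃) with hνdef
  have hν0 : 0 ≤ ν := hνΔ0.trans (le_max_left _ _)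
  have hν1 : ν < 1 := max_lt hνΔ1 (max_lt hθF1 hν₃1)
  have hpowΔ : ∀ l : ℕ, νΔ ^ l ≤ ν ^ l := fun l => pow_le_pow_left₀ hνΔ0 (le_max_left _ _) l
  have hpowF : ∀ l : ℕ, θF ^ l ≤ ν ^ l := fun l => pow_le_pow_left₀ hθF0 ((le_max_left _ _).trans (le_max_right _ _)) l
  have hpow₃ : ∀ l : ℕ, ν₃ ^ l ≤ ν ^ l := fun l => pow_le_pow_left₀ hν₃0 ((le_max_right _ _).trans (le_max_right _ _)) l
  -- the slaved constants are nonnegative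
  have hσ₁ : 0 ≤ σ₁ := (Hh₁ 0).nonneg
  have hσ₂ : 0 ≤ σ₂ := (Hh₂ 0).nonneg
  have hσ₁d : 0 ≤ σ₁d := by have h := (Hh₁d 0).nonneg; rwa [pow_zero, mul_one] at h
  have hσ₂d : 0 ≤ σ₂d := by have h := (Hh₂d 0).nonneg; rwa [pow_zero, mul_one] at h
  -- 8b: the members and their drifts are in the ruled class (third conjunct = summability at some rate)
  have hmem := fun n => (halfMember_legLetter_mem hLc1 hrb cE cVH cΛ cE₂ cB Tc hB hBt (ε := (1 : ℝ)) (by norm_num) n).2.2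
  have hmemd := fun n => (halfMember_legDrift_mem hLc1 hrb cE cVH cΛ cE₂ cB Tc hB hBt (ε := (1 : ℝ)) (by norm_num) n).2.2
  refine exists_allScalesSeq_JsRowD1Pin_of_windows_sourcePairForm
    (GoodL := fun (W : (Fin (3 + 1) → (Fin (3 + 1) → ℤ) → Fin (3 + 1) → (Fin (3 + 1) → ℤ) → MKer (3 + 1) (Fib 3))) (g : ℝ) =>
      (∀ (κ₁ : Fin (3 + 1)) (v : Fin (3 + 1) → ℤ) (κ₂ : Fin (3 + 1)) (x p : Fin (3 + 1) → ℤ) (f b : Fib 3),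
          |∑' v', W κ₁ v κ₂ v' x p f b| ≤ g * Real.exp (-δ * (l1 (x - v) + l1 (p - v)))) ∧
      (∀ (κ₁ κ₂ : Fin (3 + 1)) (v' x p : Fin (3 + 1) → ℤ) (f b : Fib 3),
          |∑' v, W κ₁ v κ₂ v' x p f b| ≤ g * Real.exp (-δ * (l1 (x - v') + l1 (p - v')))) ∧
      (∀ (κ₁ κ₂ : Fin (3 + 1)) (x p : Fin (3 + 1) → ℤ) (f b : Fib 3),
          |∑' v, ∑' v', W κ₁ v κ₂ v' x p f b| ≤ g * Real.exp (-δ * l1 (p - x))) ∧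
      (∀ (κ : Fin (3 + 1)) (v w x p : Fin (3 + 1) → ℤ) (f b : Fib 3),
          |∑ μ, (W κ v μ (w - unitVec μ) x p f b - W κ v μ w x p f b)|
            ≤ g * Real.exp (-δ * l1 (w - v)) * Real.exp (-δ * (l1 (x - v) + l1 (p - v)))) ∧
      (∀ (κ' : Fin (3 + 1)) (w v' x p : Fin (3 + 1) → ℤ) (f b : Fib 3),
          |∑ κ, (W κ (w - unitVec κ) κ' v' x p f b - W κ w κ' v' x p f b)|
            ≤ g * Real.exp (-δ * l1 (v' - w)) * Real.exp (-δ * (l1 (x - w) + l1 (p - w)))))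
    (GoodLS := fun (W : (Fin (3 + 1) → (Fin (3 + 1) → ℤ) → Fin (3 + 1) → (Fin (3 + 1) → ℤ) → MKer (3 + 1) (Fib 3))) (g : ℝ) =>
      (∀ (κ₁ : Fin (3 + 1)) (v : Fin (3 + 1) → ℤ) (κ₂ : Fin (3 + 1)) (x p : Fin (3 + 1) → ℤ) (f b : Fib 3),
          |∑' v', W κ₁ v κ₂ v' x p f b| ≤ g * Real.exp (-δS * (l1 (x - v) + l1 (p - v)))) ∧
      (∀ (κ₁ κ₂ : Fin (3 + 1)) (v' x p : Fin (3 + 1) → ℤ) (f b : Fib 3),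
          |∑' v, W κ₁ v κ₂ v' x p f b| ≤ g * Real.exp (-δS * (l1 (x - v') + l1 (p - v')))) ∧
      (∀ (κ₁ κ₂ : Fin (3 + 1)) (x p : Fin (3 + 1) → ℤ) (f b : Fib 3),
          |∑' v, ∑' v', W κ₁ v κ₂ v' x p f b| ≤ g * Real.exp (-δS * l1 (p - x))) ∧
      (∀ (κ : Fin (3 + 1)) (v w x p : Fin (3 + 1) → ℤ) (f b : Fib 3),
          |∑ μ, (W κ v μ (w - unitVec μ) x p f b - W κ v μ w x p f b)|
            ≤ g * Real.exp (-δS * l1 (w - v)) * Real.exp (-δS * (l1 (x - v) + l1 (p - v)))) ∧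
      (∀ (κ' : Fin (3 + 1)) (w v' x p : Fin (3 + 1) → ℤ) (f b : Fib 3),
          |∑ κ, (W κ (w - unitVec κ) κ' v' x p f b - W κ w κ' v' x p f b)|
            ≤ g * Real.exp (-δS * l1 (v' - w)) * Real.exp (-δS * (l1 (x - w) + l1 (p - w)))))
    (GoodLD := fun (W : (Fin (3 + 1) → (Fin (3 + 1) → ℤ) → Fin (3 + 1) → (Fin (3 + 1) → ℤ) → MKer (3 + 1) (Fib 3))) (g : ℝ) =>
      (∀ (κ₁ : Fin (3 + 1)) (v : Fin (3 + 1) → ℤ) (κ₂ : Fin (3 + 1)) (x p : Fin (3 + 1) → ℤ) (f b : Fib 3),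
          |∑' v', W κ₁ v κ₂ v' x p f b| ≤ g * Real.exp (-δD * (l1 (x - v) + l1 (p - v)))) ∧
      (∀ (κ₁ κ₂ : Fin (3 + 1)) (v' x p : Fin (3 + 1) → ℤ) (f b : Fib 3),
          |∑' v, W κ₁ v κ₂ v' x p f b| ≤ g * Real.exp (-δD * (l1 (x - v') + l1 (p - v')))) ∧
      (∀ (κ₁ κ₂ : Fin (3 + 1)) (x p : Fin (3 + 1) → ℤ) (f b : Fib 3),
          |∑' v, ∑' v', W κ₁ v κ₂ v' x p f b| ≤ g * Real.exp (-δD * l1 (p - x))) ∧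
      (∀ (κ : Fin (3 + 1)) (v w x p : Fin (3 + 1) → ℤ) (f b : Fib 3),
          |∑ μ, (W κ v μ (w - unitVec μ) x p f b - W κ v μ w x p f b)|
            ≤ g * Real.exp (-δD * l1 (w - v)) * Real.exp (-δD * (l1 (x - v) + l1 (p - v)))) ∧
      (∀ (κ' : Fin (3 + 1)) (w v' x p : Fin (3 + 1) → ℤ) (f b : Fib 3),
          |∑ κ, (W κ (w - unitVec κ) κ' v' x p f b - W κ w κ' v' x p f b)|
            ≤ g * Real.exp (-δD * l1 (v' - w)) * Real.exp (-δD * (l1 (x - w) + l1 (p - w)))))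
    (δ := δ) (δS := δS) (δD := δD) (k₀ := max kmin kminD + 1) (θ := θ) (Cg := Cg) (A := A) (B := B) (CF := CF) (gF := Γ₄ * CF) (C₀ := C₀) (g₀ := Γ₄ * C₀) (σ := Γ₂ * (σ₁ + σ₂))
    (θD := θD) (CgD := CgD) (AD := AD) (BD := BD) (AΔ := AΔ) (BΔ := BΔ) (CF' := cF) (gF' := Γ₄ * cF) (ν := ν) (σd := Γ₂ * (σ₁d + σ₂d))
    hLc hL2 hN hr hcE hcVH hcΛ hcE₂ hcB hTc hvh hδDpos hδD_δ hk₀ hθ0 hθ1 hCg (by linarith) hB0 hCF (mul_nonneg hΓ₄0 hCF) hC₀ (mul_nonneg hΓ₄0 hC₀)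
    (mul_nonneg hΓ₂0 (add_nonneg hσ₁ hσ₂)) ?_ ?_ ?_ ?_ ?_ ?_ ?_ hθD0 hθD1 hCgD (by linarith) hBD0 hAΔ hBΔ hcF (mul_nonneg hΓ₄0 hcF) hν0 hν1
    (mul_nonneg hΓ₂0 (add_nonneg hσ₁d hσ₂d)) ?_ ?_ ?_ ?_ ?_ ?_ hSrc hSrcX μ ν'
  · -- (H1♮)_δ: the k₀-window
    intro n W C g _ hbdd hW hL
    exact H1c r hrb n W C g hbdd hW hL.1 hL.2.1 hL.2.2.1 hL.2.2.2.1 hL.2.2.2.2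
  · -- (H1w)_{δS→δ}: the short windows
    intro p q W C g hq _ hbdd hW hL
    exact Hwc r hrb p q W C g hq hbdd hW hL.1 hL.2.1 hL.2.2.1 hL.2.2.2.1 hL.2.2.2.2
  · -- (HS)_δS
    exact fun n => (HS6 n).mono hδS6
  · -- (HSL)
    exact fun n => hΓ₄ _ CF (HS6 n)
  · -- (Hx0)_δS
    exact Hx06.mono hδS6
  · -- (HxL0)
    exact hΓ₄ _ C₀ Hx06
  · -- (H3): the members' five rows from the slaved divergence rows
    intro n
    exact windowRows_weaken le_rfl hδ_δ₃ (hΓ₂ _ σ₁ σ₂ (hmem n) (Hh₁ n) (Hh₂ n))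
  · -- (H1♮)_δD
    intro n W C g _ hbdd hW hL
    exact H1Dc r hrb n W C g hbdd hW hL.1 hL.2.1 hL.2.2.1 hL.2.2.2.1 hL.2.2.2.2
  · -- (HwD)_{δS→δD}
    intro p q W C g hq _ hbdd hW hL
    exact HwDc r hrb p q W C g hq hbdd hW hL.1 hL.2.1 hL.2.2.1 hL.2.2.2.1 hL.2.2.2.2
  · -- (H1Δw)_{δ→δD}: the kernel-drift windows, geometric rate weakened to `ν`
    intro l q W C g hq _ hbdd hW hL
    have h := HΔc r hrb l q W C g hq hbdd hW hL.1 hL.2.1 hL.2.2.1 hL.2.2.2.1 hL.2.2.2.2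
    have hC : 0 ≤ C := hW.nonneg
    have hg : 0 ≤ g := nonneg_of_abs_le_mul_exp (hL.2.2.1 0 0 0 0 (Sum.inl 0) (Sum.inl 0))
    exact locStencil₂_weaken h (mul_le_mul_of_nonneg_left (hpowΔ l) (by positivity)) le_rfl
  · -- (HS′)_δS at the common `ν`
    intro l
    exact locStencil₂_weaken (HS6' l) (mul_le_mul_of_nonneg_left (hpowF l) hcF) hδS6
  · -- (HSL′)
    intro l
    refine windowRows_weaken ?_ le_rfl (hΓ₄ _ (cF * θF ^ l) (HS6' l))
    rw [← mul_assoc]; exact mul_le_mul_of_nonneg_left (hpowF l) (mul_nonneg hΓ₄0 hcF)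
  · -- (H3d): the drifts' five rows from the slaved divergence-drift rows
    intro n
    have hm := hmemd n
    rw [← rdiv_comp_sub] at hm
    have h := hΓ₂ _ (σ₁d * ν₃ ^ n) (σ₂d * ν₃ ^ n) hm (Hh₁d n) (Hh₂d n)
    rw [rdiv_comp_sub] at h
    refine windowRows_weaken ?_ hδD_δ₃ h
    have e : Γ₂ * (σ₁d * ν₃ ^ n + σ₂d * ν₃ ^ n) = Γ₂ * (σ₁d + σ₂d) * ν₃ ^ n := by ring
    rw [e]; exact mul_le_mul_of_nonneg_left (hpow₃ n) (mul_nonneg hΓ₂0 (add_nonneg hσ₁d hσ₂d))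

end Summit.QuantumFields.BalabanUV.Beta.GAN24.WrecAtEvenHalfRowsOfNaturalWindowsSourcePairForm

end
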